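import Literature.Analysis.FluidPDE.CurlFreeLiouville
import Literature.Analysis.FluidPDE.VorticityCalculus
import HarnessLib

/-!
# Uniqueness of the decaying Helmholtz–Hodge (Leray) decomposition on `ℝ³`

Analysis/FluidPDE support file (serves the NS-CLAIMS sweep, D-0090, cell `ns-claims`, seat
`ns-claims-salvage-p1`: the barrier entry `Literature.Barriers.NavierStokesRegularity.SupNormCZ.SupNormCalderonZygmundFailure`
exhibits explicit compactly supported Hodge triples `φ = φ₁ + φ₂`, `div φ₁ = 0`, `curl φ₂ = 0`, and quotes
that such a pair IS the Leray decomposition of `φ`; claim skeletons such as `Literature.Claims.NS.Liu2025`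
posit Hodge pairs "unique when they exist". This file proves the uniqueness.)

**Liouville form.** A `C²` vector field `H` on `ℝ³` with `curl H = 0`, `div H = 0` and `H(x) → 0` as
`|x| → ∞` vanishes identically (`eq_zero_of_curl_eq_zero_of_isDivFree_of_tendsto_zero`): by the tree's
`Literature.Analysis.FluidPDE.eq_of_curl_eq_zero_of_isDivFree_of_bounded` (KNSS 2009, Lemma 3.1: each
coordinate is a bounded harmonic function, hence constant) `H` is constant, and a constant tending to `0`
at infinity is `0`.

**Uniqueness of the decaying Hodge pair** (`hodgePair_unique`): if `φ₁ + φ₂ = ψ₁ + ψ₂` pointwise with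
`φ₁, ψ₁` divergence free, `φ₂, ψ₂` curl free, all `C²`, and the curl-free parts agree at infinity
(`φ₂ − ψ₂ → 0` along the cocompact filter — e.g. both vanish at infinity), then `φ₁ = ψ₁` and `φ₂ = ψ₂`.
This is the uniqueness clause of the Leray projection (Lemarié-Rieusset 2016, Ch. 6, Def. 6.4 and the
paragraph after it: "Uniqueness of `H⃗` is easily checked: if `∇∧H⃗ = 0` and `div H⃗ = 0`, then `ΔH⃗ = 0` … so
that `H⃗` is harmonic … if moreover `lim_{t→+∞} e^{tΔ}H⃗ = 0` then `H⃗ = 0`"), here in the classical pointwise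
decay class instead of `𝒮'` with heat-decay. Consequence (`hodgePair_unique_of_tendsto_zero`): among pairs
whose curl-free part vanishes at infinity — in particular among compactly supported or Schwartz pairs — the
decomposition is unique, so the solenoidal part is the Leray projection `ℙφ`.

## Mathlib / tree search

`lean search 'hodge.*unique|IsHodgePair.*unique'`: torus only (`Torus.helmholtz_unique`,
`TorusLerayHelmholtz`) and the bounded-domain `RellichLemmaProofs.helmholtz_unique_continuation`; nothing
on `ℝ³` with decay. Used: `eq_of_curl_eq_zero_of_isDivFree_of_bounded` (`CurlFreeLiouville`), `curl_sub`
(`VorticityCalculus`), Mathlib `Filter.mem_cocompact`, `IsCompact.exists_bound_of_continuousOn`.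

WHAT THIS IS NOT: not a claim about NS regularity or blow-up; not a claim about any author beyond the typed
locator. A Liouville-type uniqueness statement for vector fields on `ℝ³`.
-/

noncomputable section

open Set Filter Topology Function Metric

namespace Literature.Analysis.FluidPDE

/-- A continuous field tending to `0` at infinity is bounded. [folklore] -/
private theorem exists_norm_le_of_tendsto_cocompact {V : EuclideanSpace ℝ (Fin 3) → EuclideanSpace ℝ (Fin 3)} (hc : Continuous V)
    (h0 : Tendsto V (cocompact (EuclideanSpace ℝ (Fin 3))) (𝓝 0)) : ∃ M : ℝ, ∀ x, ‖V x‖ ≤ M := by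
  have h1 : ∀ᶠ x in cocompact (EuclideanSpace ℝ (Fin 3)), ‖V x‖ < 1 := by
    simpa using h0.norm.eventually (gt_mem_nhds (show ‖(0 : EuclideanSpace ℝ (Fin 3))‖ < 1 by simp))
  obtain ⟨K, hK, hKV⟩ := mem_cocompact.1 h1
  obtain ⟨C, hC⟩ := hK.exists_bound_of_continuousOn hc.continuousOn
  refine ⟨max C 1, fun x => ?_⟩
  by_cases hx : x ∈ K
  · exact (hC x hx).trans (le_max_left _ _)
  · exact (le_of_lt (hKV hx)).trans (le_max_right _ _)

/-- **Liouville for `curl H = 0`, `div H = 0` with decay**: a `C²` vector field on `ℝ³` that is curl free,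
divergence free and tends to `0` at infinity vanishes identically (it is constant by the bounded Liouville
theorem for the system, KNSS 2009 Lemma 3.1, and the constant is its limit `0`). This is the uniqueness
mechanism of the Leray projection. [cite: LemarieRieusset2016, Ch. 6 Def. 6.4 (uniqueness of the curl-free part)]
[cite: KochNadirashviliSereginSverak2009, Lemma 3.1 (arXiv p. 7)] -/
theorem eq_zero_of_curl_eq_zero_of_isDivFree_of_tendsto_zero {H : EuclideanSpace ℝ (Fin 3) → EuclideanSpace ℝ (Fin 3)} (hH : ContDiff ℝ 2 H)
    (hcurl : ∀ x, curl H x = 0) (hdiv : VectorCalculus.IsDivFree H)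
    (h0 : Tendsto H (cocompact (EuclideanSpace ℝ (Fin 3))) (𝓝 0)) : H = 0 := by
  obtain ⟨M, hM⟩ := exists_norm_le_of_tendsto_cocompact (hH.continuous) h0
  have hconst := eq_of_curl_eq_zero_of_isDivFree_of_bounded hH hcurl hdiv hM
  have hc : H = fun _ => H 0 := funext fun x => hconst x 0
  have hlim : Tendsto (fun _ : EuclideanSpace ℝ (Fin 3) => H 0) (cocompact (EuclideanSpace ℝ (Fin 3))) (𝓝 0) := hc ▸ h0
  have h00 : H 0 = 0 := tendsto_nhds_unique tendsto_const_nhds hlim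
  funext x
  rw [hconst x 0, h00, Pi.zero_apply]

/-- **Uniqueness of the decaying Helmholtz–Hodge decomposition.** If `φ₁ + φ₂ = ψ₁ + ψ₂` on `ℝ³` with
`φ₁, ψ₁` divergence free, `φ₂, ψ₂` curl free, all four `C²`, and `φ₂ − ψ₂ → 0` at infinity, then `φ₂ = ψ₂`
and `φ₁ = ψ₁`: the difference `φ₂ − ψ₂ = ψ₁ − φ₁` is curl free, divergence free and decays. (Lemarié-Rieusset:
the curl-free part of the Leray decomposition is unique once it is required to vanish at infinity.)
[cite: LemarieRieusset2016, Ch. 6 Def. 6.4 (uniqueness of the curl-free part)] -/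
theorem hodgePair_unique {φ₁ φ₂ ψ₁ ψ₂ : EuclideanSpace ℝ (Fin 3) → EuclideanSpace ℝ (Fin 3)} (hφ₁ : ContDiff ℝ 2 φ₁) (hφ₂ : ContDiff ℝ 2 φ₂)
    (hψ₁ : ContDiff ℝ 2 ψ₁) (hψ₂ : ContDiff ℝ 2 ψ₂) (hsum : ∀ x, φ₁ x + φ₂ x = ψ₁ x + ψ₂ x)
    (hdφ : VectorCalculus.IsDivFree φ₁) (hdψ : VectorCalculus.IsDivFree ψ₁)
    (hcφ : ∀ x, curl φ₂ x = 0) (hcψ : ∀ x, curl ψ₂ x = 0)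
    (h0 : Tendsto (fun x => φ₂ x - ψ₂ x) (cocompact (EuclideanSpace ℝ (Fin 3))) (𝓝 0)) : φ₂ = ψ₂ ∧ φ₁ = ψ₁ := by
  -- the difference of the curl-free parts
  set H : EuclideanSpace ℝ (Fin 3) → EuclideanSpace ℝ (Fin 3) := fun x => φ₂ x - ψ₂ x with hHdef
  have hH : ContDiff ℝ 2 H := hφ₂.sub hψ₂
  have hHeq : ∀ x, H x = ψ₁ x - φ₁ x := fun x => by
    have := hsum x
    rw [hHdef]
    -- φ₂ - ψ₂ = ψ₁ - φ₁ from φ₁ + φ₂ = ψ₁ + ψ₂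
    exact sub_eq_sub_iff_add_eq_add.2 (by rw [add_comm, this, add_comm])
  have hHcurl : ∀ x, curl H x = 0 := fun x => by
    have h := curl_sub (f := φ₂) (g := ψ₂) (x := x) ((hφ₂.differentiable (by norm_num)) x)
      ((hψ₂.differentiable (by norm_num)) x)
    simp only [hHdef]
    rw [h, hcφ x, hcψ x, sub_zero]
  have hHdiv : VectorCalculus.IsDivFree H := by
    intro x
    have hH' : H = fun y => ψ₁ y - φ₁ y := funext hHeq
    rw [hH', VectorCalculus.divergence,
      fderiv_fun_sub ((hψ₁.differentiable (by norm_num)) x) ((hφ₁.differentiable (by norm_num)) x)]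
    have e1 := hdψ x
    have e2 := hdφ x
    rw [VectorCalculus.divergence] at e1 e2
    rw [ContinuousLinearMap.toLinearMap_sub, map_sub, e1, e2, sub_zero]
  have hH0 : H = 0 := eq_zero_of_curl_eq_zero_of_isDivFree_of_tendsto_zero hH hHcurl hHdiv h0
  have h2 : φ₂ = ψ₂ := by
    funext x
    have := congrFun hH0 x
    simp only [hHdef, Pi.zero_apply, sub_eq_zero] at this
    exact this
  refine ⟨h2, ?_⟩
  funext x
  have := hsum x
  rw [h2] at this
  exact add_right_cancel this

/-- **Uniqueness among pairs vanishing at infinity**: two Helmholtz–Hodge decompositions of the same field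
on `ℝ³` whose curl-free parts both tend to `0` at infinity (e.g. both compactly supported — Mathlib
`HasCompactSupport.is_zero_at_infty` — or both of rapid decay) coincide: the solenoidal part of any such pair is
the Leray projection `ℙφ`.
[cite: LemarieRieusset2016, Ch. 6 Def. 6.4 (uniqueness of the curl-free part)] -/
theorem hodgePair_unique_of_tendsto_zero {φ₁ φ₂ ψ₁ ψ₂ : EuclideanSpace ℝ (Fin 3) → EuclideanSpace ℝ (Fin 3)} (hφ₁ : ContDiff ℝ 2 φ₁)
    (hφ₂ : ContDiff ℝ 2 φ₂) (hψ₁ : ContDiff ℝ 2 ψ₁) (hψ₂ : ContDiff ℝ 2 ψ₂)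
    (hsum : ∀ x, φ₁ x + φ₂ x = ψ₁ x + ψ₂ x)
    (hdφ : VectorCalculus.IsDivFree φ₁) (hdψ : VectorCalculus.IsDivFree ψ₁)
    (hcφ : ∀ x, curl φ₂ x = 0) (hcψ : ∀ x, curl ψ₂ x = 0)
    (h0φ : Tendsto φ₂ (cocompact (EuclideanSpace ℝ (Fin 3))) (𝓝 0)) (h0ψ : Tendsto ψ₂ (cocompact (EuclideanSpace ℝ (Fin 3))) (𝓝 0)) :
    φ₂ = ψ₂ ∧ φ₁ = ψ₁ :=
  hodgePair_unique hφ₁ hφ₂ hψ₁ hψ₂ hsum hdφ hdψ hcφ hcψ (by simpa using h0φ.sub h0ψ)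

end Literature.Analysis.FluidPDE

end
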